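/-
Copyright (c) 2026. All rights reserved.
Released under Apache 2.0 license as described in the file LICENSE.
-/
import Literature.NumberTheory.Automorphic.HurwitzOrderNormCount
import HarnessLib

/-!
# Legendre's four triangular numbers theorem: `δ₄(n) = σ(2n + 1)`

`δ₄(n) = #{(x₁, x₂, x₃, x₄) ∈ ℕ⁴ : T_{x₁} + T_{x₂} + T_{x₃} + T_{x₄} = n}`, `T_x = x(x+1)/2` (ordered quadruples). Ono–Robins–Wahl,
§3 **Theorem 3**: «If `δ₄(n)` is the number of representations of `n` as a sum of `4` triangular numbers, then
`δ₄(n) = σ₁(2n + 1)`. This result was known to Legendre [14]» (Legendre, *Traité des fonctions elliptiques*, vol. 3,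
1828), with «the following interesting multiplicativity property for `δ₄(n)`: `δ₄(m)δ₄(n) = δ₄(2mn + m + n)` when
`(2m + 1, 2n + 1) = 1`». Ono–Robins–Wahl read it off the weight-`2` Eisenstein series `qΨ⁴(q²) = Σ σ₁(2n+1) q^{2n+1}` on
`Γ₀(4)`; here it is derived from JACOBI'S FOUR-SQUARE COUNT of the tree (`r₄(N) = 8Σ_{d∣N, 4∤d} d`,
`Waring/JacobiFourSquareTheorem`, in the forms `r₄(4m) = 24σ_odd(m)`, `r₄(m) = 8σ(m)` (`m` odd) of
`Automorphic/HurwitzOrderNormCount`) through their Proposition 2 («`δ_k(n) = q_k(8n + k)`», `q_k(N)` the representations of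
`N` by `k` odd squares, `n = Σ T_{xᵢ} ⟺ 8n + k = Σ (2xᵢ + 1)²`):

  a representation `y₁² + y₂² + y₃² + y₄² = 8n + 4` has all `yᵢ` odd or all `yᵢ` even (squares are `0, 1 (mod 4)`); the
  all-even ones are the `r₄(2n + 1) = 8σ(2n+1)` representations of `2n + 1` doubled, the all-odd ones are `2⁴·δ₄(n)`
  (signs times `yᵢ = ±(2xᵢ + 1)`), and `r₄(8n + 4) = 24σ(2n + 1)`; hence `16·δ₄(n) = 16·σ(2n + 1)`.

* §1 `odd_or_even_of_sum_four_sq` (the parity dichotomy), **`card_four_odd_sq_eq_sixteen_mul_card_triangular`**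
  (`#{y ∈ ℤ⁴ odd : Σ yᵢ² = 8n+4} = 16·δ₄(n)`: an explicit equivalence with `{x ∈ ℕ⁴ : Σ T_{xᵢ} = n} × {±1}⁴` — Prop. 2 with
  signs), `card_four_even_sq` (`#{y ∈ ℤ⁴ even : Σ yᵢ² = 8n+4} = r₄(2n+1) = 8σ(2n+1)`), `card_sphere_eq_card_odd_add_card_even`,
  `card_sphere` (`r₄(8n+4) = 24σ(2n+1)`), **`card_four_odd_sq`** (`= 16σ(2n+1)`: «`q₄(8n+4) = σ(2n+1)`» up to the `2⁴` signs);
* §2 **`card_triangular_eq`** — LEGENDRE'S THEOREM `δ₄(n) = Σ_{d ∣ 2n+1} d`, `card_triangular_eq_sigma` (`= σ₁(2n+1)`),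
  **`card_triangular_mul`** (`δ₄(m)δ₄(n) = δ₄(2mn + m + n)` for `(2m+1, 2n+1) = 1`), `card_triangular_pos`, and the values
  `δ₄(0) = 1`, `δ₄(1) = 4`, `δ₄(4) = 13` (the coefficients `q + 4q³ + … + 13q⁹` printed by Ono–Robins–Wahl).

## Sources

* K. Ono, S. Robins, P. T. Wahl, *On the representation of integers as sums of triangular numbers*, Aequationes Math.
  50 (1995) 73–94: §2 Prop. 2 (`δ_k(n) = q_k(8n+k)`), §3 Thm. 3 (`δ₄(n) = σ₁(2n+1)`, Legendre; multiplicativity), the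
  expansion `qΨ⁴(q²) = q + 4q³ + 6q⁵ + 8q⁷ + 13q⁹ + …`. [cite: OnoRobinsWahl1995, §2 Prop. 2; §3 Thm. 3]
* A.-M. Legendre, *Traité des fonctions elliptiques*, vol. 3 (1828) — as cited by Ono–Robins–Wahl [14]. [cite: OnoRobinsWahl1995, §3 Thm. 3 (reference [14])]
* C. G. J. Jacobi's four-square theorem, through the tree (`JacobiFourSquares.card_sum_four_sq_eq_eight_mul_sum_divisors`;
  Hardy–Wright Thm. 386). [cite: HardyWright2008, Thm 386]

## Scope (honest)

Theorems only — no definition, no named fact, no instance; the equivalences are built inside the proofs. Quadruples are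
ordered and range over `ℕ⁴` as `Fin 4 → ℕ` (Ono–Robins–Wahl's `δ₄`), squares over `Fin 4 → ℤ` as in the tree's `r₄`;
`T_x` is spelled `x * (x + 1) / 2`. No modular forms are used or claimed.
-/

open Finset
open Literature.NumberTheory.Automorphic.HurwitzOrder

namespace Literature.NumberTheory.Waring.FourTriangularNumbersCount

/-! ## §1 Four odd squares: `#{y ∈ ℤ⁴ odd : Σ yᵢ² = 8n + 4} = 16·δ₄(n)`, and the even ones -/

section Parity

/-- Four squares summing to `0 (mod 4)` are all odd or all even. [folklore] -/
private theorem zmod4_sq4 : ∀ a b c d : ZMod 4, a ^ 2 + b ^ 2 + c ^ 2 + d ^ 2 = 0 →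
    ((a = 1 ∨ a = 3) ∧ (b = 1 ∨ b = 3) ∧ (c = 1 ∨ c = 3) ∧ (d = 1 ∨ d = 3)) ∨
    ((a = 0 ∨ a = 2) ∧ (b = 0 ∨ b = 2) ∧ (c = 0 ∨ c = 2) ∧ (d = 0 ∨ d = 2)) := by
  decide

/-- `(x : ZMod 4) ∈ {1, 3}` means `x` is odd. [folklore] -/
private theorem odd_of_zmod4 {x : ℤ} (h : (x : ZMod 4) = 1 ∨ (x : ZMod 4) = 3) : Odd x := by
  rw [Int.odd_iff]
  rcases h with h | h
  · have := (ZMod.intCast_eq_intCast_iff' x 1 4).mp (by simpa using h)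
    omega
  · have := (ZMod.intCast_eq_intCast_iff' x 3 4).mp (by simpa using h)
    omega

/-- `(x : ZMod 4) ∈ {0, 2}` means `x` is even. [folklore] -/
private theorem even_of_zmod4 {x : ℤ} (h : (x : ZMod 4) = 0 ∨ (x : ZMod 4) = 2) : Even x := by
  rw [Int.even_iff]
  rcases h with h | h
  · have := (ZMod.intCast_eq_intCast_iff' x 0 4).mp (by simpa using h)
    omega
  · have := (ZMod.intCast_eq_intCast_iff' x 2 4).mp (by simpa using h)
    omega

/-- **If `y₁² + y₂² + y₃² + y₄² = 8n + 4` then the `yᵢ` are all odd or all even** (a square is `0` or `1 (mod 4)`, so the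
number of odd `yᵢ` is `≡ 0 (mod 4)`). [cite: OnoRobinsWahl1995, §3 (proof of Thm. 3)] -/
theorem odd_or_even_of_sum_four_sq {v : Fin 4 → ℤ} {n : ℕ} (h : ∑ i, v i ^ 2 = ((8 * n + 4 : ℕ) : ℤ)) :
    (∀ i, Odd (v i)) ∨ (∀ i, Even (v i)) := by
  have h4 : ((v 0 : ℤ) : ZMod 4) ^ 2 + ((v 1 : ℤ) : ZMod 4) ^ 2 + ((v 2 : ℤ) : ZMod 4) ^ 2 +
      ((v 3 : ℤ) : ZMod 4) ^ 2 = 0 := by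
    have := congrArg (Int.cast : ℤ → ZMod 4) h
    rw [Fin.sum_univ_four] at this
    push_cast at this
    rw [this, show (8 : ZMod 4) = 0 from rfl, show (4 : ZMod 4) = 0 from rfl, zero_mul, zero_add]
  rcases zmod4_sq4 _ _ _ _ h4 with ⟨h0, h1, h2, h3⟩ | ⟨h0, h1, h2, h3⟩
  · refine Or.inl fun i => ?_
    fin_cases i
    exacts [odd_of_zmod4 h0, odd_of_zmod4 h1, odd_of_zmod4 h2, odd_of_zmod4 h3]
  · refine Or.inr fun i => ?_
    fin_cases i
    exacts [even_of_zmod4 h0, even_of_zmod4 h1, even_of_zmod4 h2, even_of_zmod4 h3]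

end Parity

section Bijection

/-- Four odd squares `Σ (2pᵢ + 1)² = 8n + 4` give `Σ T_{pᵢ} = n` (with `pᵢ = aᵢ/2` for odd `aᵢ`). [cite: OnoRobinsWahl1995, §2 Prop. 2] -/
private theorem tri_of_sq {a b c d n : ℕ} (ha : a % 2 = 1) (hb : b % 2 = 1) (hc : c % 2 = 1) (hd : d % 2 = 1)
    (h : a ^ 2 + b ^ 2 + c ^ 2 + d ^ 2 = 8 * n + 4) :
    a / 2 * (a / 2 + 1) / 2 + b / 2 * (b / 2 + 1) / 2 + c / 2 * (c / 2 + 1) / 2 + d / 2 * (d / 2 + 1) / 2 = n := by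
  obtain ⟨p, rfl⟩ : ∃ p, a = 2 * p + 1 := ⟨a / 2, by omega⟩
  obtain ⟨q, rfl⟩ : ∃ q, b = 2 * q + 1 := ⟨b / 2, by omega⟩
  obtain ⟨r, rfl⟩ : ∃ r, c = 2 * r + 1 := ⟨c / 2, by omega⟩
  obtain ⟨s, rfl⟩ : ∃ s, d = 2 * s + 1 := ⟨d / 2, by omega⟩
  have e1 : (2 * p + 1) / 2 = p := by omega
  have e2 : (2 * q + 1) / 2 = q := by omega
  have e3 : (2 * r + 1) / 2 = r := by omega
  have e4 : (2 * s + 1) / 2 = s := by omega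
  rw [e1, e2, e3, e4]
  have key : p * (p + 1) + q * (q + 1) + r * (r + 1) + s * (s + 1) = 2 * n := by nlinarith [h]
  obtain ⟨kp, hkp⟩ := Nat.even_mul_succ_self p
  obtain ⟨kq, hkq⟩ := Nat.even_mul_succ_self q
  obtain ⟨kr, hkr⟩ := Nat.even_mul_succ_self r
  obtain ⟨ks, hks⟩ := Nat.even_mul_succ_self s
  generalize p * (p + 1) = P at hkp key ⊢
  generalize q * (q + 1) = Q at hkq key ⊢
  generalize r * (r + 1) = R at hkr key ⊢
  generalize s * (s + 1) = T at hks key ⊢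
  omega

/-- `Σ T_{xᵢ} = n` gives `Σ (2xᵢ + 1)² = 8n + 4`. [cite: OnoRobinsWahl1995, §2 Prop. 2] -/
private theorem sq_of_tri {p q r s n : ℕ}
    (h : p * (p + 1) / 2 + q * (q + 1) / 2 + r * (r + 1) / 2 + s * (s + 1) / 2 = n) :
    (2 * p + 1) ^ 2 + (2 * q + 1) ^ 2 + (2 * r + 1) ^ 2 + (2 * s + 1) ^ 2 = 8 * n + 4 := by
  obtain ⟨kp, hkp⟩ := Nat.even_mul_succ_self p
  obtain ⟨kq, hkq⟩ := Nat.even_mul_succ_self q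
  obtain ⟨kr, hkr⟩ := Nat.even_mul_succ_self r
  obtain ⟨ks, hks⟩ := Nat.even_mul_succ_self s
  have key : p * (p + 1) + q * (q + 1) + r * (r + 1) + s * (s + 1) = 2 * n := by
    have hp' := hkp; have hq' := hkq; have hr' := hkr; have hs' := hks
    generalize p * (p + 1) = P at hp' h ⊢
    generalize q * (q + 1) = Q at hq' h ⊢
    generalize r * (r + 1) = R at hr' h ⊢
    generalize s * (s + 1) = T at hs' h ⊢
    omega
  nlinarith [key]

/-- `(±z)² = z²` for the sign switch `bif b then −z else z`. [folklore] -/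
private theorem sq_bif_neg (b : Bool) (z : ℤ) : (bif b then -z else z) ^ 2 = z ^ 2 := by
  cases b <;> simp

/-- `|±m| = m`. [folklore] -/
private theorem natAbs_bif_neg (b : Bool) (m : ℕ) : (bif b then -(m : ℤ) else (m : ℤ)).natAbs = m := by
  cases b <;> simp

/-- `±(2p + 1)` is odd. [folklore] -/
private theorem odd_bif_neg (b : Bool) (p : ℕ) : Odd (bif b then -(((2 * p + 1 : ℕ)) : ℤ) else ((2 * p + 1 : ℕ) : ℤ)) := by
  cases b
  · exact ⟨p, by push_cast; simp⟩
  · exact ⟨-(p : ℤ) - 1, by push_cast; simp; ring⟩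

/-- The sign of `±(2p + 1)` is `b`. [folklore] -/
private theorem decide_bif_neg (b : Bool) (p : ℕ) :
    decide ((bif b then -(((2 * p + 1 : ℕ)) : ℤ) else ((2 * p + 1 : ℕ) : ℤ)) < 0) = b := by
  cases b
  · simp only [cond_false, decide_eq_false_iff_not, not_lt]
    positivity
  · simp only [cond_true, decide_eq_true_eq, Left.neg_neg_iff]
    positivity

/-- An odd integer is `± (2·(|z|/2) + 1)` with the sign read off `z < 0`. [folklore] -/
private theorem bif_decide_eq (z : ℤ) (hz : z.natAbs % 2 = 1) :
    (bif decide (z < 0) then -(((2 * (z.natAbs / 2) + 1 : ℕ)) : ℤ) else ((2 * (z.natAbs / 2) + 1 : ℕ) : ℤ)) = z := by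
  by_cases h : z < 0
  · rw [decide_eq_true h, cond_true]
    omega
  · rw [decide_eq_false h, cond_false]
    omega

/-- **`#{y ∈ ℤ⁴ : Σ yᵢ² = 8n + 4, all yᵢ odd} = 16·δ₄(n)`** (Ono–Robins–Wahl Prop. 2, `δ₄(n) = q₄(8n + 4)`, with the `2⁴`
signs): the explicit equivalence `y ↦ (((|yᵢ| − 1)/2)ᵢ, (yᵢ < 0)ᵢ)` with `{x ∈ ℕ⁴ : Σ T_{xᵢ} = n} × Bool⁴`.
[cite: OnoRobinsWahl1995, §2 Prop. 2 and §3 Thm. 3] -/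
theorem card_four_odd_sq_eq_sixteen_mul_card_triangular (n : ℕ) :
    Nat.card {v : Fin 4 → ℤ // ∑ i, v i ^ 2 = ((8 * n + 4 : ℕ) : ℤ) ∧ ∀ i, Odd (v i)} =
      16 * Nat.card {x : Fin 4 → ℕ // ∑ i, x i * (x i + 1) / 2 = n} := by
  have habs : ∀ y : {v : Fin 4 → ℤ // ∑ i, v i ^ 2 = ((8 * n + 4 : ℕ) : ℤ) ∧ ∀ i, Odd (v i)},
      (y.1 0).natAbs ^ 2 + (y.1 1).natAbs ^ 2 + (y.1 2).natAbs ^ 2 + (y.1 3).natAbs ^ 2 = 8 * n + 4 := by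
    rintro ⟨v, hv, -⟩
    rw [Fin.sum_univ_four] at hv
    apply Nat.cast_injective (R := ℤ)
    rw [Nat.cast_add, Nat.cast_add, Nat.cast_add, Nat.cast_pow, Nat.cast_pow, Nat.cast_pow, Nat.cast_pow,
      Int.natAbs_sq, Int.natAbs_sq, Int.natAbs_sq, Int.natAbs_sq]
    exact hv
  have hodd : ∀ y : {v : Fin 4 → ℤ // ∑ i, v i ^ 2 = ((8 * n + 4 : ℕ) : ℤ) ∧ ∀ i, Odd (v i)}, ∀ i,
      (y.1 i).natAbs % 2 = 1 := fun y i => Nat.odd_iff.1 (Int.natAbs_odd.2 (y.2.2 i))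
  let e : {v : Fin 4 → ℤ // ∑ i, v i ^ 2 = ((8 * n + 4 : ℕ) : ℤ) ∧ ∀ i, Odd (v i)} ≃
      {x : Fin 4 → ℕ // ∑ i, x i * (x i + 1) / 2 = n} × (Fin 4 → Bool) :=
    { toFun := fun y =>
        (⟨fun i => (y.1 i).natAbs / 2, by
            rw [Fin.sum_univ_four]
            exact tri_of_sq (hodd y 0) (hodd y 1) (hodd y 2) (hodd y 3) (habs y)⟩,
          fun i => decide (y.1 i < 0))
      invFun := fun x =>
        ⟨fun i => bif x.2 i then -(((2 * x.1.1 i + 1 : ℕ)) : ℤ) else ((2 * x.1.1 i + 1 : ℕ) : ℤ), by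
          refine ⟨?_, fun i => odd_bif_neg _ _⟩
          have hx := x.1.2
          rw [Fin.sum_univ_four] at hx ⊢
          rw [sq_bif_neg, sq_bif_neg, sq_bif_neg, sq_bif_neg]
          exact_mod_cast sq_of_tri hx⟩
      left_inv := by
        rintro ⟨v, hv, hvo⟩
        apply Subtype.ext
        funext i
        exact bif_decide_eq (v i) (hodd ⟨v, hv, hvo⟩ i)
      right_inv := by
        rintro ⟨⟨x, hx⟩, b⟩
        refine Prod.ext (Subtype.ext (funext fun i => ?_)) (funext fun i => ?_)
        · show (bif b i then -(((2 * x i + 1 : ℕ)) : ℤ) else ((2 * x i + 1 : ℕ) : ℤ)).natAbs / 2 = x i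
          rw [natAbs_bif_neg]
          omega
        · exact decide_bif_neg (b i) (x i) }
  rw [Nat.card_congr e, Nat.card_prod, Nat.card_eq_fintype_card (α := Fin 4 → Bool), Fintype.card_fun,
    Fintype.card_bool, Fintype.card_fin]
  ring

/-- **`#{y ∈ ℤ⁴ : Σ yᵢ² = 8n + 4, all yᵢ even} = r₄(2n + 1)`** (`y = 2u`). [cite: OnoRobinsWahl1995, §3 (proof of Thm. 3)] [cite: HardyWright2008, Thm 386] -/
theorem card_four_even_sq_eq (n : ℕ) :
    Nat.card {v : Fin 4 → ℤ // ∑ i, v i ^ 2 = ((8 * n + 4 : ℕ) : ℤ) ∧ ∀ i, Even (v i)} =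
      Nat.card {u : Fin 4 → ℤ // ∑ i, u i ^ 2 = ((2 * n + 1 : ℕ) : ℤ)} := by
  refine Nat.card_congr
    { toFun := fun y => ⟨fun i => y.1 i / 2, ?_⟩
      invFun := fun u => ⟨fun i => 2 * u.1 i, ?_, fun i => even_two_mul _⟩
      left_inv := fun y => Subtype.ext (funext fun i => Int.mul_ediv_cancel' (even_iff_two_dvd.mp (y.2.2 i)))
      right_inv := fun u => Subtype.ext (funext fun i => by
        show 2 * u.1 i / 2 = u.1 i
        exact Int.mul_ediv_cancel_left _ two_ne_zero) }
  · have h2 : ∀ i, 2 * (y.1 i / 2) = y.1 i := fun i => Int.mul_ediv_cancel' (even_iff_two_dvd.mp (y.2.2 i))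
    have hsum : ∑ i, y.1 i ^ 2 = 4 * ∑ i, (y.1 i / 2) ^ 2 := by
      rw [mul_sum]
      exact sum_congr rfl fun i _ => by
        conv_lhs => rw [← h2 i]
        ring
    have h4 : (4 : ℤ) * ∑ i, (y.1 i / 2) ^ 2 = 4 * ((2 * n + 1 : ℕ) : ℤ) := by
      rw [← hsum, y.2.1]
      push_cast
      ring
    exact mul_left_cancel₀ (by norm_num) h4
  · have hsum : ∑ i, (2 * u.1 i) ^ 2 = 4 * ∑ i, u.1 i ^ 2 := by
      rw [mul_sum]
      exact sum_congr rfl fun i _ => by ring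
    rw [hsum, u.2]
    push_cast
    ring

/-- `#{y ∈ ℤ⁴ : Σ yᵢ² = 8n + 4, all yᵢ even} = r₄(2n + 1) = 8σ(2n + 1)` (Jacobi). [cite: HardyWright2008, Thm 386] -/
theorem card_four_even_sq (n : ℕ) :
    Nat.card {v : Fin 4 → ℤ // ∑ i, v i ^ 2 = ((8 * n + 4 : ℕ) : ℤ) ∧ ∀ i, Even (v i)} =
      8 * ∑ d ∈ (2 * n + 1).divisors, d := by
  rw [card_four_even_sq_eq, card_sum_four_sq_of_odd (by exact ⟨n, rfl⟩ : Odd (2 * n + 1))]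

/-- `r₄(8n + 4) = 24σ(2n + 1)` (Jacobi: `r₄(4m) = 24σ(m)` for odd `m`). [cite: HardyWright2008, Thm 386] -/
theorem card_sphere (n : ℕ) :
    Nat.card {v : Fin 4 → ℤ // ∑ i, v i ^ 2 = ((8 * n + 4 : ℕ) : ℤ)} = 24 * ∑ d ∈ (2 * n + 1).divisors, d := by
  rw [show (8 * n + 4 : ℕ) = 4 * (2 * n + 1) by ring, card_sum_four_sq_four_mul (by omega),
    sum_odd_divisors_of_odd (by exact ⟨n, rfl⟩ : Odd (2 * n + 1))]

/-- **`r₄(8n + 4) = #{all odd} + #{all even}`** (the parity dichotomy as a count). [cite: OnoRobinsWahl1995, §3 (proof of Thm. 3)] -/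
theorem card_sphere_eq_card_odd_add_card_even (n : ℕ) :
    Nat.card {v : Fin 4 → ℤ // ∑ i, v i ^ 2 = ((8 * n + 4 : ℕ) : ℤ)} =
      Nat.card {v : Fin 4 → ℤ // ∑ i, v i ^ 2 = ((8 * n + 4 : ℕ) : ℤ) ∧ ∀ i, Odd (v i)} +
        Nat.card {v : Fin 4 → ℤ // ∑ i, v i ^ 2 = ((8 * n + 4 : ℕ) : ℤ) ∧ ∀ i, Even (v i)} := by
  classical
  haveI : Finite {v : Fin 4 → ℤ // ∑ i, v i ^ 2 = ((8 * n + 4 : ℕ) : ℤ)} := by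
    refine Nat.finite_of_card_ne_zero ?_
    rw [card_sphere]
    have h1 : 1 ≤ ∑ d ∈ (2 * n + 1).divisors, d :=
      single_le_sum (f := fun d => d) (fun _ _ => Nat.zero_le _) (Nat.one_mem_divisors.mpr (by omega))
    omega
  have e₁ : {y : {v : Fin 4 → ℤ // ∑ i, v i ^ 2 = ((8 * n + 4 : ℕ) : ℤ)} // ∀ i, Odd (y.1 i)} ≃
      {v : Fin 4 → ℤ // ∑ i, v i ^ 2 = ((8 * n + 4 : ℕ) : ℤ) ∧ ∀ i, Odd (v i)} :=
    Equiv.subtypeSubtypeEquivSubtypeInter (fun v : Fin 4 → ℤ => ∑ i, v i ^ 2 = ((8 * n + 4 : ℕ) : ℤ))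
      (fun v => ∀ i, Odd (v i))
  have e₂ : {y : {v : Fin 4 → ℤ // ∑ i, v i ^ 2 = ((8 * n + 4 : ℕ) : ℤ)} // ¬ ∀ i, Odd (y.1 i)} ≃
      {v : Fin 4 → ℤ // ∑ i, v i ^ 2 = ((8 * n + 4 : ℕ) : ℤ) ∧ ∀ i, Even (v i)} :=
    (Equiv.subtypeEquivRight fun y =>
      ⟨fun h => (odd_or_even_of_sum_four_sq y.2).resolve_left h,
        fun h h' => (Int.not_odd_iff_even.mpr (h 0)) (h' 0)⟩).trans
      (Equiv.subtypeSubtypeEquivSubtypeInter (fun v : Fin 4 → ℤ => ∑ i, v i ^ 2 = ((8 * n + 4 : ℕ) : ℤ))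
        (fun v => ∀ i, Even (v i)))
  rw [← Nat.card_congr (Equiv.sumCompl fun y : {v : Fin 4 → ℤ // ∑ i, v i ^ 2 = ((8 * n + 4 : ℕ) : ℤ)} =>
      ∀ i, Odd (y.1 i)), Nat.card_sum, Nat.card_congr e₁, Nat.card_congr e₂]

/-- **`#{y ∈ ℤ⁴ : Σ yᵢ² = 8n + 4, all yᵢ odd} = 16·σ(2n + 1)`** — Ono–Robins–Wahl's `q₄(8n + 4) = σ₁(2n + 1)` up to the `2⁴`
signs. [cite: OnoRobinsWahl1995, §2 Prop. 2 and §3 Thm. 3] -/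
theorem card_four_odd_sq (n : ℕ) :
    Nat.card {v : Fin 4 → ℤ // ∑ i, v i ^ 2 = ((8 * n + 4 : ℕ) : ℤ) ∧ ∀ i, Odd (v i)} =
      16 * ∑ d ∈ (2 * n + 1).divisors, d := by
  have h := card_sphere_eq_card_odd_add_card_even n
  rw [card_sphere, card_four_even_sq] at h
  omega

end Bijection

/-! ## §2 Legendre's theorem `δ₄(n) = σ(2n + 1)` -/

section Count

/-- **LEGENDRE'S FOUR TRIANGULAR NUMBERS THEOREM (Ono–Robins–Wahl Thm. 3): `δ₄(n) = σ₁(2n + 1) = Σ_{d ∣ 2n+1} d`** — the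
number of ordered quadruples `(x₁, x₂, x₃, x₄) ∈ ℕ⁴` with `T_{x₁} + T_{x₂} + T_{x₃} + T_{x₄} = n`. [cite: OnoRobinsWahl1995, §3 Thm. 3] -/
theorem card_triangular_eq (n : ℕ) :
    Nat.card {x : Fin 4 → ℕ // ∑ i, x i * (x i + 1) / 2 = n} = ∑ d ∈ (2 * n + 1).divisors, d := by
  have h := card_four_odd_sq n
  rw [card_four_odd_sq_eq_sixteen_mul_card_triangular] at h
  omega

/-- The same with Mathlib's `σ₁`. [cite: OnoRobinsWahl1995, §3 Thm. 3] -/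
theorem card_triangular_eq_sigma (n : ℕ) :
    Nat.card {x : Fin 4 → ℕ // ∑ i, x i * (x i + 1) / 2 = n} = ArithmeticFunction.sigma 1 (2 * n + 1) := by
  rw [card_triangular_eq, ArithmeticFunction.sigma_one_apply]

/-- **`δ₄(m)·δ₄(n) = δ₄(2mn + m + n)` when `(2m + 1, 2n + 1) = 1`** («interesting multiplicativity property», from
`(2m+1)(2n+1) = 2(2mn + m + n) + 1` and the multiplicativity of `σ₁`). [cite: OnoRobinsWahl1995, §3 (after Thm. 3)] -/
theorem card_triangular_mul {m n : ℕ} (h : (2 * m + 1).Coprime (2 * n + 1)) :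
    Nat.card {x : Fin 4 → ℕ // ∑ i, x i * (x i + 1) / 2 = m} * Nat.card {x : Fin 4 → ℕ // ∑ i, x i * (x i + 1) / 2 = n} =
      Nat.card {x : Fin 4 → ℕ // ∑ i, x i * (x i + 1) / 2 = 2 * m * n + m + n} := by
  rw [card_triangular_eq_sigma, card_triangular_eq_sigma, card_triangular_eq_sigma,
    show 2 * (2 * m * n + m + n) + 1 = (2 * m + 1) * (2 * n + 1) by ring,
    ArithmeticFunction.isMultiplicative_sigma.map_mul_of_coprime h]

/-- `δ₄(n) > 0` (every `n` is a sum of four triangular numbers — already of three, by Gauss). [cite: OnoRobinsWahl1995, §1 and §3 Thm. 3] -/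
theorem card_triangular_pos (n : ℕ) : 0 < Nat.card {x : Fin 4 → ℕ // ∑ i, x i * (x i + 1) / 2 = n} := by
  rw [card_triangular_eq]
  exact lt_of_lt_of_le Nat.one_pos
    (single_le_sum (f := fun d => d) (fun _ _ => Nat.zero_le _) (Nat.one_mem_divisors.mpr (by omega)))

/-- `δ₄(0) = σ(1) = 1`. [cite: OnoRobinsWahl1995, §3 Thm. 3] -/
theorem card_triangular_zero : Nat.card {x : Fin 4 → ℕ // ∑ i, x i * (x i + 1) / 2 = 0} = 1 := by
  rw [card_triangular_eq]
  decide

/-- `δ₄(1) = σ(3) = 4` («`qΨ⁴(q²) = q + 4q³ + …`»). [cite: OnoRobinsWahl1995, §3 (expansion of qΨ⁴(q²))] -/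
theorem card_triangular_one : Nat.card {x : Fin 4 → ℕ // ∑ i, x i * (x i + 1) / 2 = 1} = 4 := by
  rw [card_triangular_eq]
  decide

/-- `δ₄(4) = σ(9) = 13` («`… + 13q⁹ + …`»). [cite: OnoRobinsWahl1995, §3 (expansion of qΨ⁴(q²))] -/
theorem card_triangular_four : Nat.card {x : Fin 4 → ℕ // ∑ i, x i * (x i + 1) / 2 = 4} = 13 := by
  rw [card_triangular_eq]
  decide

end Count

end Literature.NumberTheory.Waring.FourTriangularNumbersCount
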